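import Literature.AlgebraicGeometry.RealAlgebraic.DividingCurves
import HarnessLib

/-!
# The unit circle: halves and complex orientation signs, computed

Topic `Literature/AlgebraicGeometry/RealAlgebraic`; companion of `DividingCurves` (Rokhlin's type I
curves, halves and complex orientation signs). A fully worked example showing that the definitions
`IsHalf`, `halfSideSign`, `gradOutwardSign`, `complexOrientationSignAt` of that file are not junk,
on `p = x² + y² - 1` over `ℚ`:

* `UnitCircle.param` — the rational parametrisation `ζ ↦ ((ζ + ζ⁻¹)/2, i(ζ⁻¹ - ζ)/2)` of the
  complex circle by `ζ = x + iy ∈ ℂˣ` (`x - iy = ζ⁻¹`); `UnitCircle.norm_ne_one_of_mem_nonRealLocus`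
  — `|x + iy| ≠ 1` at non-real points.
* `UnitCircle.innerHalf = {|x + iy| < 1}` is a half (`UnitCircle.isHalf_innerHalf`: it is the
  continuous image of the strip `(0,1) × ℝ` in polar coordinates, and a connected subset of the
  non-real locus meeting it stays in it), the non-real locus is `innerHalf ∪ conj '' innerHalf`
  (`UnitCircle.nonRealLocus_poly_eq_union`), the two differ (`UnitCircle.image_star_innerHalf_ne`),
  and these are all the halves (`UnitCircle.isHalf_iff`).
* At the real point `v = (1, 0)`: `∇p(v) = (2, 0)` (`UnitCircle.realGrad_poly`),
  `⟪Im w, J∇p(v)⟫ = 2 Im y` (`UnitCircle.imPairing_posTangent_poly`); near `v` a non-real point of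
  the circle is in the inner half iff `Im y > 0` (`UnitCircle.eventually_mem_innerHalf_iff`, from the
  identity `Im y · (1 + |ζ|²) = Re x · (1 - |ζ|²)` on the circle), whence
  `halfSideSign = +1` (`UnitCircle.halfSideSign_innerHalf`; the opposite germ condition fails along
  the curve `r ↦ param r`, `r → 1⁻`); `∇p(v)` points out of the unit disc
  (`UnitCircle.gradOutwardSign_oval = 1`: the ray `{(t, 0), t ≥ 1 + 2s}` is unbounded off the
  circle, the point `(1 - 2s, 0)` has its complementary component inside the bounded disc); so
  `complexOrientationSignAt = +1` for the inner half — the complex orientation it induces on the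
  circle is counter-clockwise, as computed by hand in the design note of `DividingCurves` — and `-1`
  for the outer half (`UnitCircle.complexOrientationSignAt_image_star_innerHalf`).

## References

* [DegtyarevKharlamov2000] A. Degtyarev, V. Kharlamov, *Topological properties of real algebraic
  varieties: du côté de chez Rokhlin* (2000), §1 (halves, complex orientations).
* [Natanzon2004] S. Natanzon, *Moduli of Riemann Surfaces, Real Algebraic Curves, and Their
  Superanalogs* (2004), Ch. 2 §1.1.
-/

noncomputable section

open MvPolynomial Set Filter
open scoped _root_.Topology _root_.ComplexConjugate

namespace Literature.AlgebraicGeometry.RealAlgebraic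

/-! ### The unit circle: halves and orientation signs computed (the definitions are not junk)

For `p = x² + y² - 1` over `ℚ`, at the real point `v = (1, 0)`: `∇p(v) = (2, 0)`, `J ∇p(v) = (0, 2)`,
the inner half `H = {|x + iy| < 1}` (`= {Im θ > 0}` for `x + iy = e^{iθ}`) lies, near `v`, exactly
on the side `⟪Im w, J ∇p(v)⟫ = 2 Im y > 0`, and `∇p(v)` points out of the unit disc; so
`halfSideSign = gradOutwardSign = complexOrientationSignAt = +1`: the complex orientation of the
circle induced from the inner half is counter-clockwise (module docstring), and from the outer
half `conj '' H` clockwise. -/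

namespace UnitCircle

/-- The unit circle polynomial `x² + y² - 1` over `ℚ`. [folklore] -/
def poly : MvPolynomial (Fin 2) ℚ := X 0 ^ 2 + X 1 ^ 2 - 1

/-- The *inner half* `{(x, y) ∈ X(ℂ) ∖ X(ℝ) | |x + iy| < 1}` of the complex unit circle
(`= {Im θ > 0}` for `x + iy = e^{iθ}`). [folklore] -/
def innerHalf : Set (Fin 2 → ℂ) := {w | w ∈ nonRealLocus poly ∧ ‖w 0 + Complex.I * w 1‖ < 1}

/-- The real unit circle, the oval of `poly`. [folklore] -/
def oval : Set (Fin 2 → ℝ) := {u | u 0 ^ 2 + u 1 ^ 2 = 1}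

/-- Unfolding the non-real locus of the circle. [folklore] -/
theorem mem_nonRealLocus_poly_iff (w : Fin 2 → ℂ) :
    w ∈ nonRealLocus poly ↔ w 0 ^ 2 + w 1 ^ 2 - 1 = 0 ∧ ∃ i, (w i).im ≠ 0 := by
  rw [mem_nonRealLocus_iff]
  simp only [poly, map_sub, map_add, map_pow, aeval_X, map_one]

/-- `∂p/∂x = 2x`. [folklore] -/
theorem pderiv_zero_poly : pderiv 0 poly = 2 * X 0 := by
  simp [poly, pderiv_X]

/-- `∂p/∂y = 2y`. [folklore] -/
theorem pderiv_one_poly : pderiv 1 poly = 2 * X 1 := by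
  simp [poly, pderiv_X]

/-- The real point `(1, 0)` seen in `ℂ²`. [folklore] -/
theorem ofReal_one_zero : (fun j => (((![1, 0] : Fin 2 → ℝ) j : ℝ) : ℂ)) = ![(1 : ℂ), 0] := by
  funext j
  fin_cases j <;> simp

/-- `∇p(1, 0) = (2, 0)`. [folklore] -/
theorem realGrad_poly : realGrad poly ![1, 0] = ![2, 0] := by
  funext i
  unfold realGrad
  rw [ofReal_one_zero]
  fin_cases i
  · simp [pderiv_zero_poly]
  · simp [pderiv_one_poly]

/-- `⟪Im w, J ∇p(1, 0)⟫ = 2 Im y`. [folklore] -/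
theorem imPairing_posTangent_poly (w : Fin 2 → ℂ) :
    imPairing (posTangent poly ![1, 0]) w = 2 * (w 1).im := by
  simp only [imPairing, posTangent, realGrad_poly, Matrix.cons_val_zero, Matrix.cons_val_one]
  ring

/-- **The key identity on the complex circle**: for `x² + y² = 1` with `x = a + ib`, `y = c + id`,
`|x + iy|² (a + d) = a - d` (because `x - iy = (x + iy)⁻¹`), hence `d (1 + |x + iy|²) = a (1 - |x + iy|²)`.
[folklore] -/
theorem im_mul_one_add_normSq {w : Fin 2 → ℂ} (hw : w 0 ^ 2 + w 1 ^ 2 - 1 = 0) :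
    (w 1).im * (1 + Complex.normSq (w 0 + Complex.I * w 1)) =
      (w 0).re * (1 - Complex.normSq (w 0 + Complex.I * w 1)) := by
  set a := (w 0).re with ha
  set b := (w 0).im with hb
  set c := (w 1).re with hc
  set d := (w 1).im with hd
  have E1 : a ^ 2 - b ^ 2 + c ^ 2 - d ^ 2 = 1 := by
    have := congrArg Complex.re hw
    simp only [Complex.sub_re, Complex.add_re, Complex.one_re, Complex.zero_re, sq, Complex.mul_re]
      at this
    rw [ha, hb, hc, hd]
    nlinarith [this]
  have E2 : a * b + c * d = 0 := by
    have := congrArg Complex.im hw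
    simp only [Complex.sub_im, Complex.add_im, Complex.one_im, Complex.zero_im, sq, Complex.mul_im]
      at this
    rw [ha, hb, hc, hd]
    nlinarith [this]
  have hN : Complex.normSq (w 0 + Complex.I * w 1) = (a - d) ^ 2 + (b + c) ^ 2 := by
    rw [Complex.normSq_apply]
    simp only [Complex.add_re, Complex.mul_re, Complex.I_re, Complex.I_im, Complex.add_im,
      Complex.mul_im, zero_mul, one_mul, zero_sub, zero_add]
    rw [ha, hb, hc, hd]
    ring
  rw [hN]
  linear_combination (a - d) * E1 + 2 * (b + c) * E2

/-- **Which side is the inner half**: at a point of the complex circle with `Re x > 0`,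
`|x + iy| < 1 ↔ Im y > 0`. [folklore] -/
theorem norm_lt_one_iff_im_pos {w : Fin 2 → ℂ} (hw : w 0 ^ 2 + w 1 ^ 2 - 1 = 0) (hre : 0 < (w 0).re) :
    ‖w 0 + Complex.I * w 1‖ < 1 ↔ 0 < (w 1).im := by
  have key := im_mul_one_add_normSq hw
  have hN0 : 0 ≤ Complex.normSq (w 0 + Complex.I * w 1) := Complex.normSq_nonneg _
  have hnorm : ‖w 0 + Complex.I * w 1‖ < 1 ↔ Complex.normSq (w 0 + Complex.I * w 1) < 1 := by
    rw [Complex.normSq_eq_norm_sq]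
    constructor
    · intro h
      nlinarith [norm_nonneg (w 0 + Complex.I * w 1)]
    · intro h
      nlinarith [norm_nonneg (w 0 + Complex.I * w 1)]
  rw [hnorm]
  constructor
  · intro h
    nlinarith
  · intro h
    by_contra hge
    push Not at hge
    nlinarith

/-- **The inner half lies on the positive side at `(1, 0)`**: near `(1, 0)`, a non-real point of
the circle is in the inner half iff `⟪Im w, J ∇p(1,0)⟫ = 2 Im y > 0`. [folklore] -/
theorem eventually_mem_innerHalf_iff :
    ∀ᶠ w in 𝓝[nonRealLocus poly] (fun j => (((![1, 0] : Fin 2 → ℝ) j : ℝ) : ℂ)),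
      w ∈ innerHalf ↔ 0 < imPairing (posTangent poly ![1, 0]) w := by
  rw [ofReal_one_zero, eventually_nhdsWithin_iff]
  have hU : {w : Fin 2 → ℂ | 0 < (w 0).re} ∈ 𝓝 (![(1 : ℂ), 0] : Fin 2 → ℂ) := by
    apply IsOpen.mem_nhds
    · exact isOpen_lt continuous_const (Complex.continuous_re.comp (continuous_apply 0))
    · simp
  filter_upwards [hU] with w hw hwS
  rw [mem_nonRealLocus_poly_iff] at hwS
  rw [imPairing_posTangent_poly]
  constructor
  · intro h
    have := (norm_lt_one_iff_im_pos hwS.1 hw).1 h.2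
    linarith
  · intro h
    refine ⟨(mem_nonRealLocus_poly_iff w).2 hwS, (norm_lt_one_iff_im_pos hwS.1 hw).2 ?_⟩
    linarith

/-- **On non-real points of the circle `|x + iy| ≠ 1`**: if `|x + iy| = 1 = (x + iy)(x - iy)` then
`x - iy = conj (x + iy)`, so `x` and `y` are real. [folklore] -/
theorem norm_ne_one_of_mem_nonRealLocus {w : Fin 2 → ℂ} (hw : w ∈ nonRealLocus poly) :
    ‖w 0 + Complex.I * w 1‖ ≠ 1 := by
  intro hw1
  obtain ⟨heq, i, hi⟩ := (mem_nonRealLocus_poly_iff w).1 hw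
  set a := (w 0).re with ha
  set b := (w 0).im with hb
  set c := (w 1).re with hc
  set d := (w 1).im with hd
  have E1 : a ^ 2 - b ^ 2 + c ^ 2 - d ^ 2 = 1 := by
    have := congrArg Complex.re heq
    simp only [Complex.sub_re, Complex.add_re, Complex.one_re, Complex.zero_re, sq, Complex.mul_re]
      at this
    rw [ha, hb, hc, hd]
    nlinarith [this]
  have E2 : a * b + c * d = 0 := by
    have := congrArg Complex.im heq
    simp only [Complex.sub_im, Complex.add_im, Complex.one_im, Complex.zero_im, sq, Complex.mul_im]
      at this
    rw [ha, hb, hc, hd]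
    nlinarith [this]
  have E3 : (a - d) ^ 2 + (b + c) ^ 2 = 1 := by
    have h' : ‖w 0 + Complex.I * w 1‖ ^ 2 = 1 := by rw [hw1, one_pow]
    rw [Complex.sq_norm, Complex.normSq_apply] at h'
    simp only [Complex.add_re, Complex.mul_re, Complex.I_re, Complex.I_im, Complex.add_im,
      Complex.mul_im, zero_mul, one_mul, zero_sub, zero_add] at h'
    rw [ha, hb, hc, hd]
    nlinarith [h']
  have key : ((a - d) ^ 2 + (b + c) ^ 2) * ((a + d) ^ 2 + (b - c) ^ 2) =
      (a ^ 2 - b ^ 2 + c ^ 2 - d ^ 2) ^ 2 + (2 * (a * b + c * d)) ^ 2 := by ring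
  rw [E3, E1, E2, one_mul] at key
  have E4 : (a + d) ^ 2 + (b - c) ^ 2 = 1 := by rw [key]; norm_num
  have E5 : a * d = b * c := by linear_combination (E4 - E3) / 4
  have E6 : b ^ 2 + d ^ 2 = 0 := by linear_combination (E3 - E1) / 2 + E5
  have hb0 : b = 0 := by nlinarith [sq_nonneg b, sq_nonneg d]
  have hd0 : d = 0 := by nlinarith [sq_nonneg b, sq_nonneg d]
  fin_cases i
  · exact hi hb0
  · exact hi hd0

/-- **The rational parametrisation of the complex circle** by `ζ = x + iy ∈ ℂˣ`:
`x = (ζ + ζ⁻¹)/2`, `y = i (ζ⁻¹ - ζ)/2` (so `x - iy = ζ⁻¹`; `ζ = e^{iθ}` gives `(cos θ, sin θ)`).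
[folklore] -/
def param (ζ : ℂ) : Fin 2 → ℂ :=
  ![(ζ + ζ⁻¹) / 2, Complex.I * (ζ⁻¹ - ζ) / 2]

/-- `x + iy = ζ` on the parametrisation. [folklore] -/
theorem param_zero_add (ζ : ℂ) : param ζ 0 + Complex.I * param ζ 1 = ζ := by
  simp only [param, Matrix.cons_val_zero, Matrix.cons_val_one]
  ring_nf
  rw [Complex.I_sq]
  ring

/-- `x - iy = ζ⁻¹` on the parametrisation. [folklore] -/
theorem param_zero_sub (ζ : ℂ) : param ζ 0 - Complex.I * param ζ 1 = ζ⁻¹ := by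
  simp only [param, Matrix.cons_val_zero, Matrix.cons_val_one]
  ring_nf
  rw [Complex.I_sq]
  ring

/-- The parametrisation lands on the complex circle (`ζ ≠ 0`). [folklore] -/
theorem param_eq (ζ : ℂ) (hζ : ζ ≠ 0) : param ζ 0 ^ 2 + param ζ 1 ^ 2 - 1 = 0 := by
  have h : param ζ 0 ^ 2 + param ζ 1 ^ 2 =
      (param ζ 0 + Complex.I * param ζ 1) * (param ζ 0 - Complex.I * param ζ 1) := by
    ring_nf
    rw [Complex.I_sq]
    ring
  rw [h, param_zero_add, param_zero_sub, mul_inv_cancel₀ hζ, sub_self]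

/-- The parametrisation inverts `w ↦ x + iy` on the complex circle. [folklore] -/
theorem param_eq_self {w : Fin 2 → ℂ} (hw : w 0 ^ 2 + w 1 ^ 2 - 1 = 0) :
    param (w 0 + Complex.I * w 1) = w := by
  have hprod : (w 0 + Complex.I * w 1) * (w 0 - Complex.I * w 1) = 1 := by
    have h : (w 0 + Complex.I * w 1) * (w 0 - Complex.I * w 1) = w 0 ^ 2 + w 1 ^ 2 := by
      ring_nf
      rw [Complex.I_sq]
      ring
    rw [h]
    exact (sub_eq_zero.1 hw)
  have hinv : (w 0 + Complex.I * w 1)⁻¹ = w 0 - Complex.I * w 1 :=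
    inv_eq_of_mul_eq_one_right hprod
  funext j
  fin_cases j
  · show (w 0 + Complex.I * w 1 + (w 0 + Complex.I * w 1)⁻¹) / 2 = w 0
    rw [hinv]
    ring
  · show Complex.I * ((w 0 + Complex.I * w 1)⁻¹ - (w 0 + Complex.I * w 1)) / 2 = w 1
    rw [hinv]
    ring_nf
    rw [Complex.I_sq]
    ring

/-- Points `param ζ` with `0 < |ζ| < 1` are non-real points of the circle in the inner half.
[folklore] -/
theorem param_mem_innerHalf {ζ : ℂ} (h0 : ζ ≠ 0) (h1 : ‖ζ‖ < 1) : param ζ ∈ innerHalf := by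
  refine ⟨(mem_nonRealLocus_poly_iff _).2 ⟨param_eq ζ h0, ?_⟩, by rwa [param_zero_add]⟩
  by_contra hall
  push Not at hall
  have hreal : ∀ i, conj (param ζ i) = param ζ i := fun i =>
    Complex.ext (by simp) (by simp [hall i])
  have hconj : conj ζ = ζ⁻¹ := by
    conv_lhs => rw [← param_zero_add ζ]
    rw [map_add, map_mul, Complex.conj_I, hreal 0, hreal 1, ← param_zero_sub ζ]
    ring
  have hnorm : Complex.normSq ζ = 1 := by
    have h : (Complex.normSq ζ : ℂ) = 1 := by rw [← Complex.mul_conj, hconj, mul_inv_cancel₀ h0]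
    exact_mod_cast h
  rw [Complex.normSq_eq_norm_sq] at hnorm
  nlinarith [norm_nonneg ζ]

/-- **The inner half is the image of the punctured unit disc**, in polar coordinates
`(r, t) ↦ param (r e^{it})`, `0 < r < 1`. [folklore] -/
theorem innerHalf_eq_image : innerHalf =
    (fun q : ℝ × ℝ => param ((q.1 : ℂ) * Complex.exp ((q.2 : ℂ) * Complex.I))) '' Ioo 0 1 ×ˢ univ := by
  apply Subset.antisymm
  · rintro w ⟨hwS, hlt⟩
    have heq := ((mem_nonRealLocus_poly_iff w).1 hwS).1
    set ζ := w 0 + Complex.I * w 1 with hζ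
    have hζ0 : ζ ≠ 0 := by
      intro h0
      have hprod : ζ * (w 0 - Complex.I * w 1) = w 0 ^ 2 + w 1 ^ 2 := by
        rw [hζ]
        ring_nf
        rw [Complex.I_sq]
        ring
      rw [h0, zero_mul] at hprod
      have : (w 0 ^ 2 + w 1 ^ 2 : ℂ) = 1 := sub_eq_zero.1 heq
      rw [← hprod] at this
      exact zero_ne_one this
    refine ⟨(‖ζ‖, Complex.arg ζ), ⟨⟨norm_pos_iff.2 hζ0, hlt⟩, mem_univ _⟩, ?_⟩
    simp only
    rw [Complex.norm_mul_exp_arg_mul_I, hζ, param_eq_self heq]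
  · rintro _ ⟨⟨r, t⟩, ⟨⟨hr0, hr1⟩, -⟩, rfl⟩
    apply param_mem_innerHalf
    · exact mul_ne_zero (Complex.ofReal_ne_zero.2 hr0.ne') (Complex.exp_ne_zero _)
    · rw [norm_mul, Complex.norm_exp_ofReal_mul_I, mul_one, Complex.norm_real, Real.norm_eq_abs,
        abs_of_pos hr0]
      exact hr1

/-- **The inner half is connected** (image of the connected strip `(0,1) × ℝ`). [folklore] -/
theorem isPreconnected_innerHalf : IsPreconnected innerHalf := by
  rw [innerHalf_eq_image]
  refine (isPreconnected_Ioo.prod isPreconnected_univ).image _ ?_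
  have hζ : Continuous fun q : ℝ × ℝ => (q.1 : ℂ) * Complex.exp ((q.2 : ℂ) * Complex.I) := by
    fun_prop
  have hne : ∀ q ∈ Ioo (0 : ℝ) 1 ×ˢ (univ : Set ℝ),
      (q.1 : ℂ) * Complex.exp ((q.2 : ℂ) * Complex.I) ≠ 0 := fun q hq =>
    mul_ne_zero (Complex.ofReal_ne_zero.2 hq.1.1.ne') (Complex.exp_ne_zero _)
  have hinv : ContinuousOn (fun q : ℝ × ℝ => ((q.1 : ℂ) * Complex.exp ((q.2 : ℂ) * Complex.I))⁻¹)
      (Ioo (0 : ℝ) 1 ×ˢ univ) := hζ.continuousOn.inv₀ hne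
  refine continuousOn_pi.2 fun j => ?_
  fin_cases j
  · simp only [param, Fin.zero_eta, Matrix.cons_val_zero]
    exact (hζ.continuousOn.add hinv).div_const 2
  · simp only [param, Fin.mk_one, Matrix.cons_val_one]
    exact (continuousOn_const.mul (hinv.sub hζ.continuousOn)).div_const 2

/-- **The inner half is a half** (a connected component of the non-real locus): it is connected,
and a connected subset of the non-real locus meeting it stays in it since `|x + iy|` never takes
the value `1` there. [folklore] -/
theorem isHalf_innerHalf : IsHalf poly innerHalf := by
  have h2 : (2 : ℂ)⁻¹ ≠ 0 := inv_ne_zero two_ne_zero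
  have hmem : param (2 : ℂ)⁻¹ ∈ innerHalf :=
    param_mem_innerHalf h2 (by rw [norm_inv, Complex.norm_ofNat]; norm_num)
  refine ⟨param (2 : ℂ)⁻¹, hmem.1, Subset.antisymm ?_ ?_⟩
  · exact isPreconnected_innerHalf.subset_connectedComponentIn hmem fun w hw => hw.1
  · intro q hq
    have hqS : q ∈ nonRealLocus poly := half_subset _ hq
    refine ⟨hqS, ?_⟩
    by_contra hge
    push Not at hge
    have hgt : 1 < ‖q 0 + Complex.I * q 1‖ :=
      lt_of_le_of_ne hge (Ne.symm (norm_ne_one_of_mem_nonRealLocus hqS))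
    let f : (Fin 2 → ℂ) → ℝ := fun w => ‖w 0 + Complex.I * w 1‖
    have hf : Continuous f := by fun_prop
    have himg : IsPreconnected (f '' half poly (param (2 : ℂ)⁻¹)) :=
      (isPreconnected_half _).image f hf.continuousOn
    have h1 : (1 : ℝ) ∈ f '' half poly (param (2 : ℂ)⁻¹) :=
      himg.Icc_subset ⟨_, mem_half_self hmem.1, rfl⟩ ⟨q, hq, rfl⟩ ⟨hmem.2.le, hgt.le⟩
    obtain ⟨w, hw, hw1⟩ := h1
    exact norm_ne_one_of_mem_nonRealLocus (half_subset _ hw) hw1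

/-- **The outer half is the conjugate of the inner half**: `conj` maps `x + iy = ζ` to
`conj x + i conj y = conj (x - iy) = conj ζ⁻¹`, of modulus `|ζ|⁻¹`. Hence the non-real locus of
the circle is `innerHalf ∪ conj '' innerHalf`. [folklore] -/
theorem nonRealLocus_poly_eq_union : nonRealLocus poly = innerHalf ∪ star '' innerHalf := by
  apply Subset.antisymm
  · intro w hw
    rcases lt_or_gt_of_ne (norm_ne_one_of_mem_nonRealLocus hw) with hlt | hgt
    · exact Or.inl ⟨hw, hlt⟩
    · refine Or.inr ⟨star w, ⟨(star_mem_nonRealLocus_iff poly w).2 hw, ?_⟩, star_star w⟩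
      have heq := ((mem_nonRealLocus_poly_iff w).1 hw).1
      have hprod : (w 0 + Complex.I * w 1) * (w 0 - Complex.I * w 1) = 1 := by
        have h : (w 0 + Complex.I * w 1) * (w 0 - Complex.I * w 1) = w 0 ^ 2 + w 1 ^ 2 := by
          ring_nf
          rw [Complex.I_sq]
          ring
        rw [h]
        exact sub_eq_zero.1 heq
      have hconj : (star w) 0 + Complex.I * (star w) 1 = conj (w 0 - Complex.I * w 1) := by
        simp only [star_apply, map_sub, map_mul, Complex.conj_I]
        ring
      rw [hconj, Complex.norm_conj, ← inv_eq_of_mul_eq_one_right hprod, norm_inv]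
      exact inv_lt_one_of_one_lt₀ hgt
  · rintro w (hw | ⟨w', hw', rfl⟩)
    · exact hw.1
    · exact (star_mem_nonRealLocus_iff poly w').2 hw'.1

/-- The inner half is not its own conjugate (the point `param (1/2)` of modulus `1/2` has conjugate
of modulus `2`). [folklore] -/
theorem image_star_innerHalf_ne : star '' innerHalf ≠ innerHalf := by
  intro h
  have h2 : (2 : ℂ)⁻¹ ≠ 0 := inv_ne_zero two_ne_zero
  have hmem : param (2 : ℂ)⁻¹ ∈ innerHalf :=
    param_mem_innerHalf h2 (by rw [norm_inv, Complex.norm_ofNat]; norm_num)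
  have hmem' : star (param (2 : ℂ)⁻¹) ∈ innerHalf := by
    rw [← h]
    exact ⟨_, hmem, rfl⟩
  have hlt := hmem'.2
  have hconj : (star (param (2 : ℂ)⁻¹)) 0 + Complex.I * (star (param (2 : ℂ)⁻¹)) 1 =
      conj (param (2 : ℂ)⁻¹ 0 - Complex.I * param (2 : ℂ)⁻¹ 1) := by
    simp only [star_apply, map_sub, map_mul, Complex.conj_I]
    ring
  rw [hconj, Complex.norm_conj, param_zero_sub, inv_inv, Complex.norm_ofNat] at hlt
  norm_num at hlt

/-- **The halves of the circle** are exactly the inner half and its conjugate. [folklore] -/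
theorem isHalf_iff (H : Set (Fin 2 → ℂ)) : IsHalf poly H ↔ H = innerHalf ∨ H = star '' innerHalf := by
  constructor
  · rintro ⟨w, hw, rfl⟩
    rw [nonRealLocus_poly_eq_union] at hw
    rcases hw with hw | ⟨w', hw', rfl⟩
    · exact Or.inl (isHalf_innerHalf.eq_half hw).symm
    · refine Or.inr ?_
      rw [← image_star_half, ← isHalf_innerHalf.eq_half hw']
  · rintro (rfl | rfl)
    · exact isHalf_innerHalf
    · exact isHalf_innerHalf.image_star

/-- The curve `r ↦ param r = ((r + r⁻¹)/2, i (r⁻¹ - r)/2)` of points of the inner half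
(`0 < r < 1`), tending to `(1, 0)` as `r → 1⁻`. [folklore] -/
def innerCurve (r : ℝ) : Fin 2 → ℂ :=
  param (r : ℂ)

/-- Points of `innerCurve` with `0 < r < 1` are in the inner half, with `Im y = (r⁻¹ - r)/2 > 0`.
[folklore] -/
theorem innerCurve_mem {r : ℝ} (hr0 : 0 < r) (hr1 : r < 1) :
    innerCurve r ∈ innerHalf ∧ 0 < (innerCurve r 1).im := by
  have hinv : 1 < r⁻¹ := one_lt_inv_iff₀.2 ⟨hr0, hr1⟩
  refine ⟨param_mem_innerHalf (Complex.ofReal_ne_zero.2 hr0.ne') ?_, ?_⟩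
  · rw [Complex.norm_real, Real.norm_eq_abs, abs_of_pos hr0]
    exact hr1
  · have him : (innerCurve r 1).im = (r⁻¹ - r) / 2 := by
      simp only [innerCurve, param, Matrix.cons_val_one, ← Complex.ofReal_inv]
      simp [Complex.mul_im, Complex.div_ofNat_im]
    rw [him]
    linarith

/-- `innerCurve r → (1, 0)` within the non-real locus as `r → 1⁻`. [folklore] -/
theorem tendsto_innerCurve :
    Tendsto innerCurve (𝓝[<] 1)
      (𝓝[nonRealLocus poly] (fun j => (((![1, 0] : Fin 2 → ℝ) j : ℝ) : ℂ))) := by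
  rw [ofReal_one_zero, tendsto_nhdsWithin_iff]
  constructor
  · have hco : ContinuousAt (fun r : ℝ => (r : ℂ)) 1 := Complex.continuous_ofReal.continuousAt
    have hci : ContinuousAt (fun r : ℝ => ((r : ℂ))⁻¹) 1 :=
      (continuousAt_inv₀ (by norm_num : ((1 : ℝ) : ℂ) ≠ 0)).comp hco
    have hc : ContinuousAt innerCurve 1 := by
      apply continuousAt_pi.2
      intro j
      fin_cases j
      · simp only [innerCurve, param, Fin.zero_eta, Matrix.cons_val_zero]
        exact (hco.add hci).div_const 2
      · simp only [innerCurve, param, Fin.mk_one, Matrix.cons_val_one]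
        exact (continuousAt_const.mul (hci.sub hco)).div_const 2
    have h1 : innerCurve 1 = ![(1 : ℂ), 0] := by
      funext j
      fin_cases j <;> simp [innerCurve, param]
    rw [← h1]
    exact hc.tendsto.mono_left nhdsWithin_le_nhds
  · filter_upwards [Ioo_mem_nhdsLT (zero_lt_one' ℝ)] with r hr
    exact (innerCurve_mem hr.1 hr.2).1.1

/-- **`halfSideSign` of the inner half at `(1, 0)` is `+1`.** [folklore] -/
theorem halfSideSign_innerHalf : halfSideSign poly innerHalf ![1, 0] = 1 := by
  have hpos := eventually_mem_innerHalf_iff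
  have hneg : ¬ ∀ᶠ w in 𝓝[nonRealLocus poly] (fun j => (((![1, 0] : Fin 2 → ℝ) j : ℝ) : ℂ)),
      w ∈ innerHalf ↔ imPairing (posTangent poly ![1, 0]) w < 0 := by
    intro h
    have h' := (tendsto_innerCurve.eventually h).and (Ioo_mem_nhdsLT (zero_lt_one' ℝ))
    obtain ⟨r, hr, hr01⟩ := h'.exists
    have hm := innerCurve_mem hr01.1 hr01.2
    rw [imPairing_posTangent_poly] at hr
    have := hr.1 hm.1
    linarith [hm.2]
  unfold halfSideSign
  rw [if_pos hpos, if_neg hneg]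
  norm_num

/-- A point `(t, 0)` with `t > 1` is not in the interior of the unit circle: the ray
`{(t', 0) | t' ≥ t}` through it is connected, misses the circle and is unbounded. [folklore] -/
theorem notMem_ovalInterior_of_one_lt {u : Fin 2 → ℝ} (h1 : 1 < u 0) (h2 : u 1 = 0) :
    u ∉ ovalInterior oval := by
  rintro ⟨-, hb⟩
  set ray : Set (Fin 2 → ℝ) := (fun t : ℝ => (![t, 0] : Fin 2 → ℝ)) '' Ici (u 0) with hray
  have hcont : Continuous fun t : ℝ => (![t, 0] : Fin 2 → ℝ) := by
    refine continuous_pi fun j => ?_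
    fin_cases j
    · exact continuous_id.congr fun t => by simp
    · simpa using continuous_const
  have hpc : IsPreconnected ray := isPreconnected_Ici.image _ hcont.continuousOn
  have hsub : ray ⊆ ovalᶜ := by
    rintro _ ⟨t, ht, rfl⟩
    simp only [mem_compl_iff, oval, mem_setOf_eq, Matrix.cons_val_zero, Matrix.cons_val_one]
    have : (1 : ℝ) < t := lt_of_lt_of_le h1 ht
    nlinarith
  have hu : u ∈ ray := ⟨u 0, self_mem_Ici, by funext j; fin_cases j <;> simp [h2]⟩
  have hraysub : ray ⊆ connectedComponentIn ovalᶜ u := hpc.subset_connectedComponentIn hu hsub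
  obtain ⟨R, hR⟩ := (Metric.isBounded_iff_subset_closedBall 0).1 (hb.subset hraysub)
  have hmem : (![max (u 0) (R + 1), 0] : Fin 2 → ℝ) ∈ ray :=
    ⟨max (u 0) (R + 1), mem_Ici.2 (le_max_left _ _), rfl⟩
  have hball := hR hmem
  rw [mem_closedBall_zero_iff] at hball
  have hle := le_trans (norm_le_pi_norm (![max (u 0) (R + 1), 0] : Fin 2 → ℝ) 0) hball
  simp only [Matrix.cons_val_zero, Real.norm_eq_abs] at hle
  have : R + 1 ≤ |max (u 0) (R + 1)| := le_trans (le_max_right _ _) (le_abs_self _)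
  linarith

/-- A point `(t, 0)` with `|t| < 1` is in the interior of the unit circle: its complementary
component lies in the open unit disc (a connected set off the circle containing a point of the
disc stays in the disc), which is bounded. [folklore] -/
theorem mem_ovalInterior_of_abs_lt_one {u : Fin 2 → ℝ} (h1 : |u 0| < 1) (h2 : u 1 = 0) :
    u ∈ ovalInterior oval := by
  have hu0 : u 0 ^ 2 < 1 := by nlinarith [abs_nonneg (u 0), sq_abs (u 0)]
  have huO : u ∉ oval := by
    simp only [oval, mem_setOf_eq, h2]
    nlinarith
  refine ⟨huO, ?_⟩
  set K := connectedComponentIn ovalᶜ u with hK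
  let g : (Fin 2 → ℝ) → ℝ := fun q => q 0 ^ 2 + q 1 ^ 2
  have hg : Continuous g := by fun_prop
  have hKg : ∀ q ∈ K, g q < 1 := by
    intro q hq
    by_contra hge
    push Not at hge
    have hq1 : g q ≠ 1 := fun h => (connectedComponentIn_subset _ _ hq) h
    have hgt : 1 < g q := lt_of_le_of_ne hge (Ne.symm hq1)
    have himg : IsPreconnected (g '' K) := isPreconnected_connectedComponentIn.image g hg.continuousOn
    have hgu : g u < 1 := by simp only [g, h2]; nlinarith
    have hu' : g u ∈ g '' K := ⟨u, mem_connectedComponentIn huO, rfl⟩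
    have h1mem : (1 : ℝ) ∈ g '' K := himg.Icc_subset hu' ⟨q, hq, rfl⟩ ⟨hgu.le, hgt.le⟩
    obtain ⟨q', hq', hq'1⟩ := h1mem
    exact (connectedComponentIn_subset _ _ hq') hq'1
  refine (Metric.isBounded_closedBall (x := (0 : Fin 2 → ℝ)) (r := 1)).subset fun q hq => ?_
  rw [mem_closedBall_zero_iff, pi_norm_le_iff_of_nonneg zero_le_one]
  have hq' := hKg q hq
  intro i
  rw [Real.norm_eq_abs]
  fin_cases i
  · show |q 0| ≤ 1
    nlinarith [abs_nonneg (q 0), sq_abs (q 0), sq_nonneg (q 1)]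
  · show |q 1| ≤ 1
    nlinarith [abs_nonneg (q 1), sq_abs (q 1), sq_nonneg (q 0)]

/-- **`∇p(1, 0)` points out of the unit disc**: `gradOutwardSign = +1`. [folklore] -/
theorem gradOutwardSign_oval : gradOutwardSign poly oval ![1, 0] = 1 := by
  rw [gradOutwardSign_eq_one_iff, realGrad_poly]
  filter_upwards [Ioo_mem_nhdsGT (zero_lt_one' ℝ)] with s hs
  constructor
  · apply notMem_ovalInterior_of_one_lt
    · simp
      linarith [hs.1]
    · simp
  · apply mem_ovalInterior_of_abs_lt_one
    · simp
      rw [abs_lt]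
      constructor <;> linarith [hs.1, hs.2]
    · simp

/-- **The complex orientation of the unit circle induced from the inner half is
counter-clockwise** (at `(1, 0)`): `complexOrientationSignAt = +1`. [folklore] -/
theorem complexOrientationSignAt_innerHalf :
    complexOrientationSignAt poly innerHalf oval ![1, 0] = 1 := by
  rw [complexOrientationSignAt, halfSideSign_innerHalf, gradOutwardSign_oval, mul_one]

/-- **… and from the outer half `conj '' innerHalf` it is clockwise**: `-1`. [folklore] -/
theorem complexOrientationSignAt_image_star_innerHalf :
    complexOrientationSignAt poly (star '' innerHalf) oval ![1, 0] = -1 := by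
  rw [complexOrientationSignAt_image_star, complexOrientationSignAt_innerHalf]

end UnitCircle

end Literature.AlgebraicGeometry.RealAlgebraic
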